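import Mathlib.Analysis.SpecialFunctions.Complex.Circle
import Mathlib.Algebra.Polynomial.Roots
import Mathlib.Topology.Algebra.Polynomial
import Mathlib.Topology.Order.IntermediateValue
import Mathlib.Order.Fin.Basic
import HarnessLib

/-!
# WeilTypeLadder · real-rootedness criterion for the R3 placements of cyclic CM subfields (shared helper)

b2b cell `hweil` (packet `run/shared/lean/b2b/hodge-weil/`, report `b2b-hweil-pv3-g44/HIGHER-DEGREE-PLACEMENTS.md`). The R3 placements
of this chair for a CM subfield `K′ ⊂ ℚ(ζ_m)` use an ANTI-INVARIANT generator `θ` (`θ̄ = −θ`), whose minimal polynomial is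
`P(T) = P₀(T²)` with `P₀` the minimal polynomial of `θ² ∈ K′⁺` (totally real): all roots of `P₀` are real (and negative), so every
complex root `ρ` of `P` has `ρ² ∈ ℝ`, hence `ρ̄ = −ρ` — the rung's hypotheses «no real root» and «the CM involution is a polynomial
(`Q = −T`)» become elementary. [P3-g43] ADDENDUM A proved the real-rootedness of the cubic `P₀` for `ℚ(ζ₁₉)^{C₃}` by hand
(three intermediate values and a hand elimination). This file proves the GENERAL criterion once, for every degree:

* `exists_strictMono_roots_of_sign_changes`: a continuous `f : ℝ → ℝ` with `n + 1` consecutive sign changes at points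
  `u 0 < u 1 < ⋯ < u (n+1)` has `n + 1` strictly increasing roots (intermediate value theorem);
* `exists_ofReal_eq_of_strictMono_roots`: if a monic `g ∈ ℝ[T]` of degree `n + 1` has `n + 1` strictly increasing real roots,
  then every complex root of `g` is real (root counting: `g = ∏ (T − tᵢ)`);
* `exists_ofReal_eq_of_sign_changes`, `conj_eq_self_of_sign_changes`: the two combined — `n + 1` sign changes of a monic real
  polynomial of degree `n + 1` force every complex root to be real;
* `conj_eq_neg_of_conj_sq_eq` : `ρ̄² = ρ²`, `ρ̄ ≠ ρ` ⟹ `ρ̄ = −ρ`.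

Used by `WeilTypeLadderCyclicPrymThirtyOneDecic.lean` (`P₀` quintic), `…ThirtySevenDuodecic.lean` (sextic), `…FortyThreeTetradecic.lean`
(septic). Elementary real analysis / algebra (folklore); no definition, no named fact, no `sorry`.
-/

noncomputable section

-- every declaration of this problem lives in `Summit.HodgeConjecture.HodgeConjecture.…` (summit = sub-problem)
set_option linter.dupNamespace false

open Polynomial

namespace Summit.HodgeConjecture.HodgeConjecture.WeilTypeLadder

/-- **Sign changes give strictly increasing roots.** If `f : ℝ → ℝ` is continuous, `u 0 < u 1 < ⋯ < u (n+1)` and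
`f (u i) · f (u (i+1)) < 0` for `i ≤ n`, then `f` has roots `t 0 < t 1 < ⋯ < t n` (with `u i < t i < u (i+1)`).
Intermediate value theorem on each `[u i, u (i+1)]`. [folklore] -/
theorem exists_strictMono_roots_of_sign_changes {f : ℝ → ℝ} (hf : Continuous f) (n : ℕ) (u : ℕ → ℝ)
    (hu : ∀ i, i ≤ n → u i < u (i + 1)) (hsign : ∀ i, i ≤ n → f (u i) * f (u (i + 1)) < 0) :
    ∃ t : Fin (n + 1) → ℝ, StrictMono t ∧ ∀ i, f (t i) = 0 := by
  have key : ∀ i, i ≤ n → ∃ x, u i < x ∧ x < u (i + 1) ∧ f x = 0 := by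
    intro i hi
    have hab : u i ≤ u (i + 1) := (hu i hi).le
    rcases mul_neg_iff.1 (hsign i hi) with ⟨ha, hb⟩ | ⟨ha, hb⟩
    · obtain ⟨x, hx, hfx⟩ := intermediate_value_Ioo' hab hf.continuousOn ⟨hb, ha⟩
      exact ⟨x, hx.1, hx.2, hfx⟩
    · obtain ⟨x, hx, hfx⟩ := intermediate_value_Ioo hab hf.continuousOn ⟨ha, hb⟩
      exact ⟨x, hx.1, hx.2, hfx⟩
  choose! T hT using key
  refine ⟨fun i => T i.val, ?_, fun i => (hT i.val (Nat.lt_succ_iff.1 i.isLt)).2.2⟩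
  refine Fin.strictMono_iff_lt_succ.2 fun i => ?_
  have hi : (i : ℕ) + 1 ≤ n := Nat.succ_le_of_lt i.isLt
  simp only [Fin.val_castSucc, Fin.val_succ]
  calc T i < u (i + 1) := (hT i (le_of_lt i.isLt)).2.1
    _ < T (i + 1) := (hT (i + 1) hi).1

/-- **Root counting.** If a monic `g ∈ ℝ[T]` of degree `n + 1` has `n + 1` strictly increasing real roots `t`, then
`g = ∏ᵢ (T − tᵢ)` and every complex root of `g` is real. [folklore] -/
theorem exists_ofReal_eq_of_strictMono_roots {g : Polynomial ℝ} {n : ℕ} (hg : g.Monic) (hdeg : g.natDegree = n + 1)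
    (t : Fin (n + 1) → ℝ) (ht : StrictMono t) (hroot : ∀ i, g.eval (t i) = 0) {z : ℂ}
    (hz : Polynomial.aeval z g = 0) : ∃ r : ℝ, (r : ℂ) = z := by
  classical
  have hg0 : g ≠ 0 := hg.ne_zero
  set S : Finset ℝ := Finset.univ.image t with hS
  have hScard : S.card = n + 1 := by
    rw [hS, Finset.card_image_of_injective _ ht.injective, Finset.card_univ, Fintype.card_fin]
  have hsub : S.val ≤ g.roots := by
    rw [Multiset.le_iff_subset S.nodup]
    intro x hx
    rw [Finset.mem_val, hS, Finset.mem_image] at hx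
    obtain ⟨i, -, rfl⟩ := hx
    exact (Polynomial.mem_roots hg0).2 (hroot i)
  have hcard : Multiset.card g.roots = g.natDegree := by
    refine le_antisymm (Polynomial.card_roots' g) ?_
    rw [hdeg, ← hScard]
    exact Multiset.card_le_card hsub
  have hprod := Polynomial.prod_multiset_X_sub_C_of_monic_of_roots_card_eq hg hcard
  have h0 : Polynomial.aeval z ((g.roots.map fun a => X - C a).prod) = 0 := by rw [hprod]; exact hz
  rw [map_multiset_prod, Multiset.map_map, Multiset.prod_eq_zero_iff, Multiset.mem_map] at h0
  obtain ⟨r, -, hr⟩ := h0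
  refine ⟨r, ?_⟩
  simp only [Function.comp_apply, map_sub, Polynomial.aeval_X, Polynomial.aeval_C, Complex.coe_algebraMap,
    sub_eq_zero] at hr
  exact hr.symm

/-- **Sign-change criterion.** A monic `g ∈ ℝ[T]` of degree `n + 1` with `n + 1` consecutive sign changes
(`g(u i)·g(u (i+1)) < 0`, `u` increasing, `i ≤ n`) has only REAL complex roots. [folklore] -/
theorem exists_ofReal_eq_of_sign_changes (g : Polynomial ℝ) (n : ℕ) (hg : g.Monic) (hdeg : g.natDegree = n + 1)
    (u : ℕ → ℝ) (hu : ∀ i, i ≤ n → u i < u (i + 1))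
    (hsign : ∀ i, i ≤ n → g.eval (u i) * g.eval (u (i + 1)) < 0) {z : ℂ} (hz : Polynomial.aeval z g = 0) :
    ∃ r : ℝ, (r : ℂ) = z := by
  obtain ⟨t, ht, hroot⟩ := exists_strictMono_roots_of_sign_changes g.continuous n u hu hsign
  exact exists_ofReal_eq_of_strictMono_roots hg hdeg t ht hroot hz

/-- **Sign-change criterion, conjugation form**: under the hypotheses of `exists_ofReal_eq_of_sign_changes` every complex root
`z` of `g` is fixed by complex conjugation. [folklore] -/
theorem conj_eq_self_of_sign_changes (g : Polynomial ℝ) (n : ℕ) (hg : g.Monic) (hdeg : g.natDegree = n + 1)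
    (u : ℕ → ℝ) (hu : ∀ i, i ≤ n → u i < u (i + 1))
    (hsign : ∀ i, i ≤ n → g.eval (u i) * g.eval (u (i + 1)) < 0) {z : ℂ} (hz : Polynomial.aeval z g = 0) :
    starRingEnd ℂ z = z := by
  obtain ⟨r, rfl⟩ := exists_ofReal_eq_of_sign_changes g n hg hdeg u hu hsign hz
  exact Complex.conj_ofReal r

/-- `ρ̄² = ρ²` and `ρ̄ ≠ ρ` force `ρ̄ = −ρ` (`ρ` is purely imaginary). [folklore] -/
theorem conj_eq_neg_of_conj_sq_eq {ρ : ℂ} (hsq : starRingEnd ℂ (ρ ^ 2) = ρ ^ 2) (hne : starRingEnd ℂ ρ ≠ ρ) :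
    starRingEnd ℂ ρ = -ρ := by
  rw [map_pow] at hsq
  rcases sq_eq_sq_iff_eq_or_eq_neg.1 hsq with h | h
  · exact absurd h hne
  · exact h

end Summit.HodgeConjecture.HodgeConjecture.WeilTypeLadder

end
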